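import Literature.NumberTheory.EllipticCurves.SteinWuthrich2013.MultiplicativeLeadingTerm
import Literature.NumberTheory.EllipticCurves.PAdicLFunctionMultiplicativeInterpolation
import Literature.NumberTheory.EllipticCurves.BSDRootNumberSmallConductorProofs
import HarnessLib

/-!
# Disegni 2020, Theorem 1 / Theorem 4 at a NON-SPLIT multiplicative prime: the `p`-adic
# Birch–Swinnerton-Dyer leading-term formula with the ANALYTIC order of `Ш`, analytic rank `≤ 1`

Topic `Literature/NumberTheory/EllipticCurves` (cluster `Disegni2020`; companions: `PAdicBSD.lean`
(`PAdicBSDConjecture`, Mazur–Tate–Teitelbaum's conjecture, whose NON-SPLIT multiplicative analogue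
this file records AS A THEOREM in analytic rank `≤ 1`, with `#Ш` replaced by `#Ш_an`),
`PAdicGrossZagier{,OddPrime}.lean` (Perrin-Riou 1987: the good ordinary case),
`SteinWuthrich2013/MultiplicativeLeadingTerm.lean` (the vocabulary at a multiplicative prime:
THE §4.2 `p`-adic height `IsMultCanonical`), `PAdicLFunctionMultiplicativeInterpolation.lean`
(`IsMultPAdicLFunctionOf f p (-1) L`, THE Mazur–Tate–Teitelbaum function at a non-split prime)).
ONE named fact (nothing asserted). HONEST FRAMING (BSD rank-≤1 residual cell `b2b-bsdres`, team
`x11b3` = N8/O2, unit `b2b-bsdres-x11b3-p2`): the cell deletes the COMBINATION-SHAPED residual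
classes of the rank-`≤ 1` BSD formula STRICTLY from published theorems and TYPES the remainder; this
file supplies the PUBLISHED `p`-adic-Gross–Zagier ∘ Gross–Zagier leading-term comparison at a
NON-SPLIT multiplicative prime — the one analytic input of the cyclotomic route (X11B-AUDIT §3bis, V4)
that the cell so far held only at good ordinary `p` (`perrinRiou_rankOne_leadingTerms{,_odd}`);
it is not a class theorem and nothing here is "finishing BSD".

## Source (held: `paper:arxiv-1609.02528`, LaTeXML text, 23 chunks; locators = chunk:line)

D. Disegni, *On the `p`-adic Birch and Swinnerton-Dyer conjecture for elliptic curves over number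
fields*, Kyoto J. Math. **60** (2020), no. 2, 473–510, doi:10.1215/21562261-2018-0012
(= arXiv:1609.02528). REFEREED.

* Standing hypothesis [p0003 L12]: "Fix a rational prime `p` and assume throughout this paper that
  `A/K` is an elliptic curve with ordinary (good or multiplicative) reduction at all primes `𝔭 ∣ p`
  of `K`." — NO parity or size condition on `p`.
* Hypothesis (`L_p`) [p0003 L35–L49]: existence of `L_p^{(Γ)}(A) ∈ 𝒪_L⟦Γ⟧ ⊗ L` with
  "`ι_∞ ι_p⁻¹ L_p^{(Γ)}(A)(χ) = ∏_{𝔭∣p} ι_∞ e_𝔭(χ_𝔭) · L(A, ι_∞χ, 1)/(|D_K|^{-1/2} Ω_A)`", "`Ω_A` is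
  the Néron period appearing in the Birch and Swinnerton-Dyer conjecture for `A`", and
  "`e_𝔭(χ_𝔭) = (1 - α_𝔭 χ(𝔭))(1 - α′_𝔭 χ(𝔭)⁻¹)` if `χ_𝔭` is unramified, `α_𝔭^{-𝔣_𝔭} τ(χ_𝔭)` if `χ_𝔭`
  is ramified", "`α_𝔭 = +1` (respectively, `α_𝔭 = -1`) if `𝔭` is a prime of split (respectively,
  non-split) multiplicative reduction", "`α′_𝔭 := 0` if `E` has multiplicative reduction"; "the
  interpolation property determines `L_p^{(Γ)}(A)` uniquely if it exists" [p0003 L51]. So at a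
  NON-SPLIT multiplicative `p`: `e_p(𝟙) = (1 - (-1))(1 - 0) = 2`.
* The order of vanishing and `d^{r̃} L_p(A, 𝟙) ∈ Sym^{r̃} Γ ⊗ L` [p0004 L6–L14]: "the image of `L_p(A)`
  in `𝓘_Γ^{r̃}/𝓘_Γ^{r̃+1} ≅ Sym^{r̃} Γ ⊗ L`, the last isomorphism being given by
  `∏_{i=1}^{r̃}(γ_i - 1) ↦ [γ_1 ⊗ ⋯ ⊗ γ_{r̃}]`", footnote: "`d^{r̃} L_p(A,𝟙)` is the analogue of the
  usual Taylor coefficient `(1/r̃!) L^{(r̃)}(A, 1)`". `S_p^{exc}` = "the set of places above `p` over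
  which `A` has split multiplicative reduction" [p0004 L21], `r̃ := r + |S_p^{exc}|` — so `r̃ = r` at
  a NON-split prime.
* Hypothesis (BSD_∞) [p0005 L1–L9]: "(1) `r_an(A) := ord_{s=1} L(A,s)` equals `r(A) := rk A(K)`;
  (2) … `|Ш(A)|_an := L^{(r)}(A,1)/(r! |D_K|^{-1/2} R_NT(A) Ω_A ∏_v c_v(A))` belongs to `ℚ^×`" with
  [p0004 L49–L52] "the Néron–Tate height pairing … whose discriminant (see Definition (def-reg) below:
  it also accounts for `|A(K)_tors|²`) on `A(K)` is denoted by `R_NT(A)`" — i.e. for `K = ℚ`,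
  `|Ш(E)|_an = (L^{(r)}(E,1)/r!) · #E(ℚ)_tors² / (Reg(E/ℚ) Ω_E ∏ c_v)`, Miller's `#Ш_an` = the tree's
  `shaAn W`.
* Conjecture (BSD_p) [p0005 L11–L36]: "… Suppose that Hypotheses (`L_p`) and (BSD_∞)–(1)-(2) are
  satisfied and that `ord_{s=1} L(A,s) = r`. … Then `L_p^{(Γ)}(A)` vanishes at `χ = 𝟙` to order at
  least `r̃`, … and `d^{r̃} L_p^{(Γ)}(A, 𝟙) = ∏_{𝔭∣p} ẽ_𝔭(𝟙) · R̃_ℓ(A) · |Ш(A)|_an ∏_v c_v(A)` in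
  `Sym^{r̃} Γ ⊗ L`", with `ẽ_𝔭(𝟙) := e_𝔭(𝟙)` for `𝔭 ∉ S_p^{exc}`, `R̃_ℓ(A)` "the discriminant of (ext-ht)
  on `A†(K)`" [p0004 L60–L62] which "(b) in the case `K = ℚ` considered in [mtt] … coincide[s]" with
  the regulator of [mtt] "if `S_p^{exc} = ∅`" [p0004 L70–L71] (Def. (def-reg): torsion² included).
* **Theorem 1** [p0005 L49–L57] (= Theorem (mainQ)): "Let `E/ℚ` be an elliptic curve of conductor
  `N` with ordinary reduction at the prime `p`. Suppose that `r_an := ord_{s=1} L(E,s) ≤ 1` and that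
  (∗) if `r_an = 1` and `S_p^{exc}(E) ≠ ∅`, then `p ≥ 5` and there exists another prime `m ≠ p` of
  multiplicative reduction for `E`. Then Hypotheses (`L_p`) and (BSD_∞)–(BSD1)-(BSD2) are
  satisfied, and Conjecture (BSD_p) holds." Restated as **Theorem 4** [p0011 L62–L70]: "Let `E/ℚ`
  be an elliptic curve with ordinary reduction at the prime `p`. Suppose that
  `r := ord_{s=1} L(E,s) ≤ 1`. Then: • If the reduction of `E` at `p` is not split multiplicative or
  `r = 0`, then Conjecture (BSD_p) holds. • If `r = 1` and the reduction of `E` at `p` is split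
  multiplicative, suppose that `p ≥ 5`. Then …"; proof of the non-split rank-one case, §3.2.1
  [p0012 L1–L6]: "Suppose that `r = 1` and the reduction is not split multiplicative. By Lemma
  (invar) we may in fact prove the formula for `E_K`, where we choose `K` to be an imaginary
  quadratic field in which all primes dividing `N` split, and such that `L(E^{(K)},1) ≠ 0`. (The
  existence of such `K` is guaranteed by [murty2].) … by Corollary (index-heeg) we may rewrite the
  `p`-adic Gross–Zagier formula of Theorem (pgz) as `d⁺L_p(A,𝟙) = ∏_{𝔭∣p} e_𝔭(𝟙) · R⁺(A) ·
  L_alg^*(A,1)`, as desired. [This argument was of course already made by Perrin-Riou [PR] when `E`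
  has good reduction.]" — Theorem (pgz) = **Theorem 3** [p0009 L72–L80] "(`p`-adic Gross–Zagier
  formula). Under the assumptions of Theorem (gz), suppose moreover that `p` splits in `K`, and that
  `E` has ordinary (good or multiplicative) reduction at `p`. Then `d⁺L_p(A,𝟙) = ∏_{𝔭∣p} e_𝔭(𝟙) ·
  c_∞(A)⁻¹ · h⁺(P(f), P(f))/δ(f)` in `Γ⁺ ⊗ L`. Note that when `E` has split multiplicative reduction,
  the identity is the trivial `0 = 0`", itself "a special case of the analogous result to [cst],
  which can be obtained by applying word for word the arguments of op. cit. to [dd] instead of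
  [yzz]" ([dd] = D. Disegni, *The `p`-adic Gross–Zagier formula on Shimura curves*, Compos. Math.
  153 (2017) 1987–2074, Thm. B: "potentially 𝔭-ordinary good or semistable reduction, `E_v/F_v`
  split, `χ` not exceptional" [corpus `paper:arxiv-1510.02114` p0008 L11]; at a non-split
  multiplicative `p` split in `K` the trivial character is NOT exceptional: App. A, Lemma (basic
  integral) [loc. cit. p0053 L8–L26], `Z_w(𝟙) = (1 - α⁻¹)/(1 - α p⁻¹) ≠ 0` for the unit character
  `α(ϖ) = -1` of `St ⊗ α` — the exceptional zero is the split case `α = 1`).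
* The heights [Kyoto p0008 L3–L45; Compos. p0007 L48]: Nekovář's canonical height `h_ℓ` with values
  in `Γ ⊗ L`; "If `χ` is not exceptional …, [it] is known to coincide with the norm-adapted height
  pairings à la Schneider [schneider, nekheights], by [nekheights], and with the Mazur–Tate [MT]
  height pairings, by [iovita-werner]" — at a NON-split prime this is the Schneider = Mazur–Tate
  height, which Stein–Wuthrich, Math. Comp. 82 (2013) §4.2 p. 15 compute by "the same formula (4.1)
  … as for the good ordinary case" and §6.1 p. 20 ("taking into account the mentioned correction by
  Werner, these heights agree with the height in Section 4.2"): the tree's `IsMultCanonical Dh q`.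

## Transcription (`thm1_padicBSD_nonsplitMultiplicative`), for `K = ℚ`, `Γ = Γ_ℚ`

`W` a globally minimal model of `E/ℚ`; `p ≠ 2` (NARROWER than print — the source fixes ANY `p`;
the tree's multiplicative height vocabulary `IsMultCanonical` / `exists_isMultCanonical` is
Stein–Wuthrich's, set up for odd `p`); non-split multiplicative reduction at `p`
(`HasMultiplicativeReductionAtPrime ∧ ¬ HasSplitMultiplicativeReductionAtPrime`, so (∗) is void and
`r̃ = r`); `ord_{s=1} L(E,s) ≤ 1` (`W.analyticRank ≤ 1`); the Tate parameter `q` of `E/ℚ_p` by its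
defining properties (`q ≠ 0`, `‖q‖ < 1`, `j(q) = j(E)`; unique, `existsUnique_tateJ_eq`); `Dh` THE
§4.2 height (`IsMultCanonical Dh q`); `f` a newform of `E`; `L` THE `Ω⁺_f`-normalised
Mazur–Tate–Teitelbaum function at the non-split prime (`IsMultPAdicLFunctionOf f p (-1) L`, unique by
boundedness; Disegni's `L_p^{(Γ_ℚ)}(E)` is Néron-normalised, i.e. `ϖ · L` with `ϖ · Ω_E = Ω⁺_f`, both
being pinned by interpolation at every finite-order character of `Γ` — `e_p(χ) = α^{-m} τ(χ)` versus
MTT's `α^{-m} p^m/τ(χ̄) = α^{-m} χ(-1) τ(χ)` —, so they agree up to the involution `γ ↦ γ⁻¹` of `Λ`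
at most, which changes the leading coefficient at order `r` by the sign `(-1)^r`). CONCLUSION, the
three printed clauses for `Γ = Γ_ℚ`, `T = γ - 1` (`d^r ↔ [T^r]`, `R_ℓ ↔ Reg_p/log_p(κγ)^r` for the
height composed with `log_p ∘ χ_cyc`, exactly the dictionary of `PAdicBSDConjecture` /
`Schneider1985_order_charGenerator` / `thm61_nonsplitMultiplicative`, BMS p. 3 `Reg_γ`):
(BSD_∞)(1) `rank E(ℚ) = r_an`; (BSD_∞)(2) `#Ш(E)_an = s ∈ ℚ^×` (`shaAn W = s`, torsion² inside
`R_NT` = inside `shaAn`); (BSD_p) `ord_{T=0} L ≥ r` and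
`ϖ · [T^r]L · log_p(γ_cyc)^r · #E(ℚ)_tors² = u · 2 · s · Reg_p(E, Dh) · ∏_v c_v` for a unit
`u ∈ ℤ_pˣ` (`e_p(𝟙) = 2`; torsion² cleared on both sides as in `PAdicBSDConjecture`). The source
proves EXACT equality in Nekovář's normalisation; "up to `u ∈ ℤ_pˣ`" absorbs the sign conventions of
the height / of `γ` / of the Gauss sum recorded above and is implied by, never stronger than, the
printed statement — it is all the cell consumes (valuations). Nothing is asserted: users take
`(h : thm1_padicBSD_nonsplitMultiplicative)`.

## What is NOT here

The split multiplicative clause of Theorems 1/4 (`p ≥ 5`, a second multiplicative prime, the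
`𝓛`-invariant and the extended height: `d²L_p(E,𝟙) = 𝓛_p(E) · R^{norm}(E) · L'_alg(E,1)`); the
good ordinary clause (= Perrin-Riou 1987, `perrinRiou_rankOne_leadingTerms_odd`, plus `r = 0`);
Theorem 2 (base change to an imaginary quadratic field, several variables); the finiteness clause
`A†(K)_{ℚ_p} ≅ H̃¹_f` of (BSD_p); `p = 2`.

## References

* D. Disegni, Kyoto J. Math. 60 (2020) 473–510, Thm. 1, Thm. 3, Thm. 4, §1.1, §3.2.1
  (`Disegni2020`). PRIMARY, read 2026-08-21 (chunks p0003–p0005, p0008–p0009, p0011–p0012).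
* D. Disegni, Compos. Math. 153 (2017) 1987–2074, Thm. B, Def. 2, Def. 4, App. A (`Disegni2017`).
* B. Mazur, J. Tate, J. Teitelbaum, Invent. Math. 84 (1986) §I.10–I.14, §II.10
  (`MazurTateTeitelbaum1986`).
* W. Stein, C. Wuthrich, Math. Comp. 82 (2013) §3.1, §4.2, §6.1 (`SteinWuthrich2013`).
* B. Perrin-Riou, Invent. Math. 89 (1987) §1.4 (`PerrinRiou1987`) — the good-reduction ancestor.
-/

noncomputable section

open scoped Classical MatrixGroups ModularForm

open CongruenceSubgroup WeierstrassCurve Literature.NumberTheory.EllipticCurves.ModularForms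
  Literature.NumberTheory.EllipticCurves.SteinWuthrich2013

namespace Literature.NumberTheory.EllipticCurves.Disegni2020

/-- **Disegni 2020, Theorem 1 (= Theorem 4, first bullet) at a NON-SPLIT multiplicative prime: the
`p`-adic Birch–Swinnerton-Dyer leading-term formula with the analytic order of `Ш`, in analytic
rank `≤ 1` — a THEOREM of the source.** As printed (Kyoto J. Math. 60 (2020), Thm. 1): "Let `E/ℚ`
be an elliptic curve of conductor `N` with ordinary reduction at the prime `p`. Suppose that
`r_an := ord_{s=1} L(E,s) ≤ 1` and that (∗) if `r_an = 1` and `S_p^{exc}(E) ≠ ∅`, then `p ≥ 5` and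
there exists another prime `m ≠ p` of multiplicative reduction for `E`. Then Hypotheses (`L_p`) and
(BSD_∞)–(BSD1)-(BSD2) are satisfied, and [the formula] (BSD_p) holds", where the formula (BSD_p) of
§1.1.4 reads "`L_p^{(Γ)}(A)` vanishes at `χ = 𝟙` to order at least `r̃` … and
`d^{r̃} L_p^{(Γ)}(A,𝟙) = ∏_{𝔭∣p} ẽ_𝔭(𝟙) · R̃_ℓ(A) · |Ш(A)|_an ∏_v c_v(A)`",
`|Ш(A)|_an := L^{(r)}(A,1)/(r! |D_K|^{-1/2} R_NT(A) Ω_A ∏_v c_v(A))` (torsion² inside `R_NT`, `R̃_ℓ`),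
`e_𝔭(𝟙) = (1 - α_𝔭)(1 - α′_𝔭)` with `α_𝔭 = -1`, `α′_𝔭 = 0` at a non-split multiplicative prime,
`S_p^{exc}` = the split multiplicative places (so (∗) is void and `r̃ = r` here); Thm. 4: "If the
reduction of `E` at `p` is not split multiplicative or `r = 0`, then (BSD_p) holds" (PROVED there,
§3.2.1: the `p`-adic Gross–Zagier formula Thm. 3 at an ordinary — good or multiplicative — `p` split
in a Heegner field, Gross–Zagier, Kolyvagin; "already made by Perrin-Riou [PR] when `E` has good
reduction"). Transcription for `K = ℚ` (module docstring): `W` globally minimal, `p ≠ 2` (narrower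
than print), non-split multiplicative reduction at `p`, `ord_{s=1} L(E,s) ≤ 1`, `q` the Tate
parameter (`q ≠ 0`, `‖q‖_p < 1`, `j(q) = j(E)`), `Dh` THE Stein–Wuthrich §4.2 height
(`IsMultCanonical Dh q` = Schneider = Mazur–Tate = Nekovář at a non-exceptional prime), `f` a
newform of `E`, `L` THE Mazur–Tate–Teitelbaum function at the non-split prime
(`IsMultPAdicLFunctionOf f p (-1) L`), `ϖ · Ω_E = Ω⁺_f`. Conclusion: `rank E(ℚ) = r_an`;
`#Ш(E)_an = s ∈ ℚ^×`; `ord_{T=0} L ≥ r_an`; and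
`ϖ · [T^{r_an}]L · log_p(γ_cyc)^{r_an} · #E(ℚ)_tors² = u · 2 · s · Reg_p(E, Dh) · ∏_v c_v`, `u ∈ ℤ_pˣ`
(printed: exact equality in Nekovář's normalisation; the unit absorbs the sign conventions of the
height, of `γ` and of the Gauss sum — implied by, never stronger than, the source). Named fact (a
published, refereed theorem); nothing asserted.
-- TODO(general form): Thm. 1 also covers good ordinary `p` (both ranks) and, under (∗), split
-- multiplicative `p ≥ 5` with the `𝓛`-invariant and the extended height; Thm. 2 treats `E_K` over
-- an imaginary quadratic `K` in `1 + s` variables. Only `K = ℚ`, non-split multiplicative `p ≠ 2`.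
[cite: Disegni2020, Thm. 1 (§1.2), Thm. 4 and §3.2.1, Thm. 3 (§2.2), formula (BSD_p) of §1.1.4, Hyp. (L_p) of §1.1.1]
[cite: Disegni2017, Thm. B and App. A Lemma (basic integral)]
[cite: SteinWuthrich2013, §4.2 (p. 15) and §6.1 (p. 20)] -/
def thm1_padicBSD_nonsplitMultiplicative : Prop :=
  ∀ (W : WeierstrassCurve ℚ) [W.IsElliptic] [W.IsGloballyMinimal] (p : ℕ) [Fact p.Prime],
    p ≠ 2 → W.HasMultiplicativeReductionAtPrime p → ¬ W.HasSplitMultiplicativeReductionAtPrime p →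
    W.analyticRank ≤ 1 →
    ∀ (q : ℚ_[p]), q ≠ 0 → ‖q‖ < 1 → tateJ q = (W.j : ℚ_[p]) →
    ∀ (Dh : PAdicHeightData W p), IsMultCanonical Dh q →
    ∀ ⦃N : ℕ⦄ [NeZero N] (f : CuspForm (Gamma0 N) 2), IsNewformOf W f →
    ∀ (L : PowerSeries ℚ_[p]), IsMultPAdicLFunctionOf f p (-1) L →
    ∀ (ϖ : ℚ), (ϖ : ℝ) * W.realPeriodRat = plusPeriod f →
      W.mordellWeilRank = W.analyticRank ∧
      (W.analyticRank : ℕ∞) ≤ L.order ∧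
      ∃ (s : ℚ) (u : ℤ_[p]ˣ), shaAn W = (s : ℂ) ∧ s ≠ 0 ∧
        (ϖ : ℚ_[p]) * PowerSeries.coeff W.analyticRank L *
            padicLog p (cyclotomicGenerator p) ^ W.analyticRank * (W.torsionOrder : ℚ_[p]) ^ 2 =
          ((u : ℤ_[p]) : ℚ_[p]) * (2 * ((s : ℚ_[p]) * padicRegulator Dh * W.tamagawaProduct))

end Literature.NumberTheory.EllipticCurves.Disegni2020

end
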